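import Literature.Geometry.Lorentzian.QuasiFinalStateDecomposition
import Literature.Geometry.Lorentzian.TimeCones
import Literature.Geometry.Lorentzian.CausalityProofs
import Literature.Geometry.Lorentzian.KerrDeSitterData
import Summits.FinalStateConjecture.FinalStateConjecture.Statement
import HarnessLib

/-!
# Stub `stub_orientationGaugeAbsorption` (G) of the birth skeleton (line `registered`) of crux
# `LogTimeThreeAnnuli.SubconvergentEraGeneric` (stmt-FinalStateConjecture-17490)

ORIENTATION GAUGE ABSORPTION (pointwise adapter, no genericity): an honest subconvergent final era whose
hole-chart time orientation is stated in the producers' member-dependent VECTOR form (together with the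
`ε`-close window member `(M, a)`, the push-forward `dΨᵢ (Λᵢ V_{M,a}(Λᵢ⁻¹(x − cᵢ)))` of that member's
Kerr–Schild field `V = Kerr.timeVector` is `g`-future-directed on `{t*ᵢ = τ, rᵢ ≤ ρ}`) is an honest
subconvergent era in the crux's `(M,a)`-uniform COVECTOR form (eventually in `τ`, every `w` whose
push-forward `dΨᵢ w` is `g`-future-directed at a point of `{t*ᵢ = τ, rᵢ ≤ ρ}` has `(Λᵢ⁻¹ w)⁰ > 0`), with
the same `m₀, χ, O, d, R` and every other clause verbatim.

Mechanism (O'Neill 1983, Ch. 5, Lemma 5.26–5.32; Dafermos–Rodnianski arXiv:0811.0354, §5.1): take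
`k = 0` and `δ‖Λᵢ‖² < 1`.  At a slab point the `C⁰` bound gives
`|g(dΨu, dΨu) − g_{M,a}(Λ⁻¹u, Λ⁻¹u)| ≤ δ‖u‖²` (`abs_pullback_sub_bilin_le`); a rest-frame-spatial `U`
(`U 0 = 0`) has `g_{M,a}(U,U) = |U|² + 2H ℓ(U)² ≥ ‖U‖²` since `H ≥ 0` (`norm_sq_le_kerr_bilin`); hence no
nonzero `u` with `(Λ⁻¹u)⁰ = 0` has a causal push-forward.  The set of `w` with `dΨ w` future-directed is
a convex cone (`IsFutureDirected.add/smul`), misses that punctured hyperplane and contains `Λ V_{M,a}`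
with `V⁰ = 1 + 2H > 0` (`Kerr.timeVector_apply_zero`), so it lies in `{(Λ⁻¹w)⁰ > 0}`
(`pos_of_isFutureDirected_of_cone`).  Uniform in the wandering member: no upper bound on `H` is used.
-/

noncomputable section

-- the doubled `FinalStateConjecture` path component is the summit/problem naming scheme
set_option linter.dupNamespace false

namespace Summit.FinalStateConjecture.FinalStateConjecture.Theorems.LogTimeThreeAnnuli.SubconvergentEraGeneric

open Set Filter Function Topology
open scoped Manifold ContDiff ENNReal
open Literature.Geometry.Lorentzian

section Cone

variable {E : Type*} [NormedAddCommGroup E] [NormedSpace ℝ E] {H : Type*} [TopologicalSpace H]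
  {I : ModelWithCorners ℝ E H} {n : ℕ∞ω} {M : Type*} [TopologicalSpace M] [ChartedSpace H M]
  [IsManifold I ∞ M]

/-- **Cone lemma.** At a point `p` of a time-oriented Lorentzian manifold let `L : F →ₗ T_pM` be linear,
`φ : F →ₗ ℝ` a functional and `v ∈ F` with `L v` future-directed and `φ v > 0`; if every nonzero `u`
with `φ u = 0` has `g(Lu, Lu) > 0`, then every `w` with `L w` future-directed has `φ w > 0` (the
future cone of push-forwards is a convex cone missing `{φ = 0} ∖ {0}` and meeting `{φ > 0}`).
O'Neill 1983, Ch. 5, Lemma 5.29. [cite: ONeill1983, Ch. 5 Lemma 5.29] -/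
theorem pos_of_isFutureDirected_of_cone {g : LorentzianMetric I n M} (τ : TimeOrientation g) {p : M}
    {F : Type*} [AddCommGroup F] [Module ℝ F] (L : F →ₗ[ℝ] TangentSpace I p) (φ : F →ₗ[ℝ] ℝ)
    {v : F} (hv : τ.IsFutureDirected (L v)) (hφv : 0 < φ v)
    (hsp : ∀ u : F, u ≠ 0 → φ u = 0 → 0 < g.val p (L u) (L u))
    {w : F} (hw : τ.IsFutureDirected (L w)) : 0 < φ w := by
  by_contra hle
  push Not at hle
  set u : F := (φ v) • w + (-(φ w)) • v with hu
  have hφu : φ u = 0 := by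
    simp only [hu, map_add, map_smul, smul_eq_mul]
    ring
  have hLu : τ.IsFutureDirected (L u) := by
    have h1 : τ.IsFutureDirected ((φ v) • L w) := hw.smul hφv
    rcases hle.lt_or_eq with hlt | heq
    · have h2 : τ.IsFutureDirected ((-(φ w)) • L v) := hv.smul (by linarith)
      have := h1.add τ h2
      simpa [hu, map_add, map_smul] using this
    · simpa [hu, heq, map_add, map_smul] using h1
  have hune : u ≠ 0 := by
    intro h0
    apply hLu.1.2
    rw [h0, map_zero]
  exact absurd hLu.1.1 (not_le.mpr (hsp u hune hφu))

end Cone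

/-- For a rest-frame-spatial vector `U` (`U 0 = 0`) and `M ≥ 0`: `‖U‖² ≤ g_{M,a}(y)(U, U)`, because
`g_{M,a} = η + 2H ℓ ⊗ ℓ` with `H ≥ 0` and `η(U, U) = |U|²`. Kerr–Schild 1965; Visser arXiv:0706.0622,
(32)–(33). [cite: KerrSchild1965] -/
theorem norm_sq_le_kerr_bilin {M : ℝ} (hM : 0 ≤ M) (a : ℝ) (y U : E4) (hU : U 0 = 0) :
    ‖U‖ ^ 2 ≤ Kerr.bilin M a y U U := by
  rw [Kerr.bilin_apply, Minkowski.bilin_apply, hU, EuclideanSpace.real_norm_sq_eq,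
    Fin.sum_univ_succ, hU]
  have hH := Kerr.scalarH_nonneg hM a y
  have hsq : ∀ i : Fin 3, U i.succ * U i.succ = U i.succ ^ 2 := fun i => by ring
  simp only [hsq]
  nlinarith [mul_self_nonneg (Kerr.nullCovector a y U)]

/-- **`C⁰` control of the pulled-back metric on a truncated slab.** If the `C⁰` deviation of `Ψ^* g`
from a comparison form `b` (the reference background `B` with its form replaced by `b`, same domain,
time and radius functions) on `{t = τ, r ≤ ρ}` is at most `δ`, then at every point `x` of that slab
`|g(dΨ u, dΨ v) − b(x)(u, v)| ≤ δ ‖u‖ ‖v‖` (operator norm of the order-`0` term of `supCkENorm`).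
DHRT arXiv:2104.08222, §1. [cite: arXiv210408222, §1] -/
theorem abs_pullback_sub_bilin_le {𝓢 : Spacetime 4} (B : ModelBackground)
    (b : E4 → E4 →L[ℝ] E4 →L[ℝ] ℝ) (Ψ : B.domain → 𝓢.carrier) {ρ τ δ : ℝ} (hδ : 0 ≤ δ)
    (h : 𝓢.truncDeviationCk {B with bilin := b} Ψ 0 ρ τ ≤ ENNReal.ofReal δ) {x : B.domain}
    (hx : x ∈ B.truncTimeSlab ρ τ) (u v : E4) :
    |𝓢.metric.val (Ψ x) (mfderiv 𝓘(ℝ, E4) (𝓡 4) Ψ x u) (mfderiv 𝓘(ℝ, E4) (𝓡 4) Ψ x v) -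
        b (x : E4) u v| ≤ δ * ‖u‖ * ‖v‖ := by
  have hx' : x ∈ ({B with bilin := b} : ModelBackground).truncTimeSlab ρ τ := hx
  have h1 : ‖iteratedFDeriv ℝ 0 (𝓢.deviationExtend {B with bilin := b} Ψ) (x : E4)‖ₑ ≤
      ENNReal.ofReal δ :=
    (enorm_iteratedFDeriv_le_supCkENorm (le_refl 0) (Set.mem_image_of_mem Subtype.val hx') _).trans h
  rw [← ofReal_norm, ENNReal.ofReal_le_ofReal_iff hδ, norm_iteratedFDeriv_zero,
    Spacetime.deviationExtend_coe] at h1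
  have h2 := (𝓢.deviation {B with bilin := b} Ψ x).le_opNorm₂ u v
  rw [Spacetime.deviation_apply, Real.norm_eq_abs] at h2
  calc _ ≤ ‖𝓢.deviation {B with bilin := b} Ψ x‖ * ‖u‖ * ‖v‖ := h2
    _ ≤ δ * ‖u‖ * ‖v‖ := by gcongr

/-- **Pointwise orientation gauge absorption.** Let `Ψ` be a chart map on the reference background
`B`, `x` a point of the slab `{t = τ, r ≤ ρ}` at which `Ψ^* g` is `δ`-close in `C⁰` to the boosted
Kerr–Schild form `(v, w) ↦ g_{M,a}(Λ⁻¹(x − c))(Λ⁻¹v, Λ⁻¹w)` of a member `M ≥ 0`, with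
`δ ‖Λ‖² < 1`, and suppose the push-forward of the member's transported time vector `Λ V_{M,a}` is
future-directed at `x`.  Then every `w` with future-directed push-forward `dΨ w` has `(Λ⁻¹ w)⁰ > 0`:
rest-frame-spatial vectors have `g_{M,a}(U, U) ≥ ‖U‖²` hence spacelike push-forwards, and the future
cone of push-forwards is convex and contains `Λ V` with `V⁰ = 1 + 2H > 0`.  O'Neill 1983, Ch. 5,
Lemma 5.29; Dafermos–Rodnianski arXiv:0811.0354, §5.1. [cite: ONeill1983, Ch. 5 Lemma 5.29]
[cite: arXiv08110354, §5.1] -/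
theorem symm_apply_zero_pos_of_isFutureDirected {𝓢 : Spacetime 4} (B : ModelBackground)
    (b : E4 → E4 →L[ℝ] E4 →L[ℝ] ℝ) (Ψ : B.domain → 𝓢.carrier) (Λ : lorentzGroup) (c : E4)
    {M a ρ τ δ : ℝ} (hM : 0 ≤ M) (hδ : 0 < δ)
    (hδΛ : δ * ‖((Λ : E4 ≃L[ℝ] E4) : E4 →L[ℝ] E4)‖ ^ 2 < 1)
    (h : 𝓢.truncDeviationCk {B with bilin := b} Ψ 0 ρ τ ≤ ENNReal.ofReal δ)
    {x : B.domain} (hx : x ∈ B.truncTimeSlab ρ τ)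
    (hb : ∀ v w, b (x : E4) v w = Kerr.bilin M a (poincareInv Λ c (x : E4))
      ((Λ : E4 ≃L[ℝ] E4).symm v) ((Λ : E4 ≃L[ℝ] E4).symm w))
    (hV : 𝓢.timeOrientation.IsFutureDirected (mfderiv 𝓘(ℝ, E4) (𝓡 4) Ψ x
      ((Λ : E4 ≃L[ℝ] E4) (Kerr.timeVector M a (poincareInv Λ c (x : E4))))))
    {w : E4} (hw : 𝓢.timeOrientation.IsFutureDirected (mfderiv 𝓘(ℝ, E4) (𝓡 4) Ψ x w)) :
    0 < (Λ : E4 ≃L[ℝ] E4).symm w 0 := by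
  -- the push-forward as a linear map and the functional `u ↦ (Λ⁻¹ u)⁰`
  let L : E4 →ₗ[ℝ] TangentSpace (𝓡 4) (Ψ x) := (mfderiv 𝓘(ℝ, E4) (𝓡 4) Ψ x).toLinearMap
  let φ : E4 →ₗ[ℝ] ℝ :=
    { toFun := fun u => (Λ : E4 ≃L[ℝ] E4).symm u 0
      map_add' := fun u u' => by simp
      map_smul' := fun r u => by simp }
  have hφ : ∀ u, φ u = (Λ : E4 ≃L[ℝ] E4).symm u 0 := fun u => rfl
  -- positive `dt*` on the member's transported time vector
  have hφv : 0 < φ ((Λ : E4 ≃L[ℝ] E4) (Kerr.timeVector M a (poincareInv Λ c (x : E4)))) := by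
    rw [hφ, ContinuousLinearEquiv.symm_apply_apply, Kerr.timeVector_apply_zero]
    linarith [Kerr.scalarH_nonneg hM a (poincareInv Λ c (x : E4))]
  -- no nonzero rest-frame-spatial vector has a causal push-forward
  have hsp : ∀ u : E4, u ≠ 0 → φ u = 0 → 0 < 𝓢.metric.val (Ψ x) (L u) (L u) := by
    intro u hu hφu
    rw [hφ] at hφu
    have hdev := abs_pullback_sub_bilin_le B b Ψ hδ.le h hx u u
    rw [hb, abs_le] at hdev
    have hker : ‖(Λ : E4 ≃L[ℝ] E4).symm u‖ ^ 2 ≤ Kerr.bilin M a (poincareInv Λ c (x : E4))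
        ((Λ : E4 ≃L[ℝ] E4).symm u) ((Λ : E4 ≃L[ℝ] E4).symm u) :=
      norm_sq_le_kerr_bilin hM a _ _ hφu
    have hnu : ‖u‖ ≤ ‖((Λ : E4 ≃L[ℝ] E4) : E4 →L[ℝ] E4)‖ * ‖(Λ : E4 ≃L[ℝ] E4).symm u‖ := by
      conv_lhs => rw [← (Λ : E4 ≃L[ℝ] E4).apply_symm_apply u]
      exact ((Λ : E4 ≃L[ℝ] E4) : E4 →L[ℝ] E4).le_opNorm ((Λ : E4 ≃L[ℝ] E4).symm u)
    have hU : 0 < ‖(Λ : E4 ≃L[ℝ] E4).symm u‖ := norm_pos_iff.mpr (by simpa using hu)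
    have hnu2 : ‖u‖ ^ 2 ≤
        ‖((Λ : E4 ≃L[ℝ] E4) : E4 →L[ℝ] E4)‖ ^ 2 * ‖(Λ : E4 ≃L[ℝ] E4).symm u‖ ^ 2 := by
      rw [← mul_pow]; exact pow_le_pow_left₀ (norm_nonneg _) hnu 2
    have hδu : δ * ‖u‖ * ‖u‖ ≤
        δ * (‖((Λ : E4 ≃L[ℝ] E4) : E4 →L[ℝ] E4)‖ ^ 2 * ‖(Λ : E4 ≃L[ℝ] E4).symm u‖ ^ 2) := by
      rw [mul_assoc, ← pow_two]
      exact mul_le_mul_of_nonneg_left hnu2 hδ.le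
    have hlt : δ * (‖((Λ : E4 ≃L[ℝ] E4) : E4 →L[ℝ] E4)‖ ^ 2 * ‖(Λ : E4 ≃L[ℝ] E4).symm u‖ ^ 2) <
        ‖(Λ : E4 ≃L[ℝ] E4).symm u‖ ^ 2 := by
      rw [← mul_assoc]
      nth_rw 2 [← one_mul (‖(Λ : E4 ≃L[ℝ] E4).symm u‖ ^ 2)]
      exact mul_lt_mul_of_pos_right hδΛ (by positivity)
    change 0 < 𝓢.metric.val (Ψ x) (mfderiv 𝓘(ℝ, E4) (𝓡 4) Ψ x u) (mfderiv 𝓘(ℝ, E4) (𝓡 4) Ψ x u)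
    linarith [hdev.1]
  exact pos_of_isFutureDirected_of_cone 𝓢.timeOrientation L φ hV hφv hsp hw

/-- **G — ORIENTATION GAUGE ABSORPTION** (registered stub `stub_orientationGaugeAbsorption` of the birth
skeleton of crux `LogTimeThreeAnnuli.SubconvergentEraGeneric`, stmt-FinalStateConjecture-17490):
pointwise on the admissible class (every datum, every MGHD with complete `𝓘⁺`; no genericity), an
honest subconvergent final era with member-dependent VECTOR-form chart-time orientation is an honest
subconvergent era in the `(M,a)`-uniform COVECTOR form, with the same `m₀, χ, O, d, R`.
O'Neill 1983, Ch. 5, Lemma 5.26–5.32; Dafermos–Rodnianski arXiv:0811.0354, §5.1.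
[cite: ONeill1983, Ch. 5 Lemma 5.29] [cite: arXiv08110354, §5.1] -/
theorem stub_orientationGaugeAbsorption : open Literature.Geometry.Lorentzian in ∀ (X : Type) [TopologicalSpace X] [ChartedSpace E3 X] [IsManifold (𝓡 3) ((⊤ : ℕ∞) : WithTop ℕ∞) X] [T2Space X] [SecondCountableTopology X] [ConnectedSpace X], ∀ D ∈ admissibleVacuumData X, ∀ 𝒟 : VacuumCauchyDevelopment D, 𝒟.IsMaximal → Summit.FinalStateConjecture.HasCompleteNullInfinity 𝒟.toCauchyDevelopment → (∃ (m₀ χ : ℝ) (O : Set 𝒟.carrier) (d : QuasiFinalStateDecomposition 𝒟.toSpacetime O 2 ⊤) (R : Fin d.N → ℝ → ℝ), 0 < m₀ ∧ χ < 1 ∧ O = Summit.FinalStateConjecture.exteriorOf 𝒟.toCauchyDevelopment d.charted ∧ Summit.FinalStateConjecture.RaysStayInClosure 𝒟.toCauchyDevelopment O ∧ (∀ i : Fin d.N, Filter.Tendsto (R i) Filter.atTop Filter.atTop ∧ ∀ τ : ℝ, max (Kerr.rPlus (d.mass i) (d.spin i)) 0 + 1 ≤ R i τ) ∧ (∀ τ₁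 : ℝ, d.τ₀ < τ₁ → O \ d.certifiedLate R τ₁ ⊆ 𝒟.metric.causalPast 𝒟.timeOrientation (d.certifiedSlab R τ₁)) ∧ (∀ i : Fin d.N, Summit.FinalStateConjecture.IsOrthochronous (d.motion i).1) ∧ (∀ᶠ τ in Filter.atTop, ∀ x ∈ (Minkowski.backgroundOn d.flatDomain).timeSlab τ, 𝒟.timeOrientation.IsFutureDirected (mfderiv 𝓘(ℝ, E4) (𝓡 4) d.flatChart x (E4.basisVector 0))) ∧ (∀ k : ℕ, Filter.Tendsto (fun τ => 𝒟.toSpacetime.deviationCk (Minkowski.backgroundOn d.flatDomain) d.flatChart k τ) Filter.atTop (nhds 0)) ∧ (∀ (i : Fin d.N) (k : ℕ) (ρ : ℝ) (ε : ENNReal), 0 < ε → ∀ᶠ τ in Filter.atTop, ∃ M a : ℝ, m₀ ≤ M ∧ M ≤ m₀⁻¹ ∧ |a| ≤ χ * M ∧ 𝒟.toSpacetime.truncDeviationCk ⟨(d.background i).domain, boostedKerrBilin (d.motion i).1 (d.motion i).2 M a, (d.background i).time, (d.background i).radius⟩ (d.chart i) k ρ τ ≤ ε ∧ 𝒟.toSpacetime.truncDeviationCk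 ⟨(d.background i).domain, boostedKerrBilin (d.motion i).1 (d.motion i).2 M a, (d.background i).time, (d.background i).radius⟩ (d.chart i) k (R i τ) τ ≤ ε ∧ ∀ x ∈ (d.background i).truncTimeSlab ρ τ, 𝒟.timeOrientation.IsFutureDirected (mfderiv 𝓘(ℝ, E4) (𝓡 4) (d.chart i) x (((d.motion i).1 : E4 ≃L[ℝ] E4) (Kerr.timeVector M a (poincareInv (d.motion i).1 (d.motion i).2 (x : E4))))))) → (∃ (m₀ χ : ℝ) (O : Set 𝒟.carrier) (d : QuasiFinalStateDecomposition 𝒟.toSpacetime O 2 ⊤) (R : Fin d.N → ℝ → ℝ), 0 < m₀ ∧ χ < 1 ∧ O = Summit.FinalStateConjecture.exteriorOf 𝒟.toCauchyDevelopment d.charted ∧ Summit.FinalStateConjecture.RaysStayInClosure 𝒟.toCauchyDevelopment O ∧ (∀ i : Fin d.N, Filter.Tendsto (R i) Filter.atTop Filter.atTop ∧ ∀ τ : ℝ, max (Kerr.rPlus (d.mass i) (d.spin i)) 0 + 1 ≤ R i τ) ∧ (∀ τ₁ : ℝ, d.τ₀ < τ₁ → O \ d.certifiedLate R τ₁ ⊆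 𝒟.metric.causalPast 𝒟.timeOrientation (d.certifiedSlab R τ₁)) ∧ (∀ i : Fin d.N, Summit.FinalStateConjecture.IsOrthochronous (d.motion i).1) ∧ (∀ (i : Fin d.N) (ρ : ℝ), ∀ᶠ τ in Filter.atTop, ∀ x ∈ (d.background i).truncTimeSlab ρ τ, ∀ w : E4, 𝒟.timeOrientation.IsFutureDirected (mfderiv 𝓘(ℝ, E4) (𝓡 4) (d.chart i) x w) → 0 < ((d.motion i).1 : E4 ≃L[ℝ] E4).symm w 0) ∧ (∀ᶠ τ in Filter.atTop, ∀ x ∈ (Minkowski.backgroundOn d.flatDomain).timeSlab τ, 𝒟.timeOrientation.IsFutureDirected (mfderiv 𝓘(ℝ, E4) (𝓡 4) d.flatChart x (E4.basisVector 0))) ∧ (∀ k : ℕ, Filter.Tendsto (fun τ => 𝒟.toSpacetime.deviationCk (Minkowski.backgroundOn d.flatDomain) d.flatChart k τ) Filter.atTop (nhds 0)) ∧ (∀ (i : Fin d.N) (k : ℕ) (ρ : ℝ) (ε : ENNReal), 0 < ε → ∀ᶠ τ in Filter.atTop, ∃ M a : ℝ, m₀ ≤ M ∧ M ≤ m₀⁻¹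 ∧ |a| ≤ χ * M ∧ 𝒟.toSpacetime.truncDeviationCk ⟨(d.background i).domain, boostedKerrBilin (d.motion i).1 (d.motion i).2 M a, (d.background i).time, (d.background i).radius⟩ (d.chart i) k ρ τ ≤ ε ∧ 𝒟.toSpacetime.truncDeviationCk ⟨(d.background i).domain, boostedKerrBilin (d.motion i).1 (d.motion i).2 M a, (d.background i).time, (d.background i).radius⟩ (d.chart i) k (R i τ) τ ≤ ε)) := by
  intro X _ _ _ _ _ _ D _ 𝒟 _ _ h
  obtain ⟨m₀, χ, O, d, R, h0, hχ, hO, hrays, hR, hexh, horth, hflat, hflatdev, hnear⟩ := h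
  refine ⟨m₀, χ, O, d, R, h0, hχ, hO, hrays, hR, hexh, horth, ?_, hflat, hflatdev, ?_⟩
  · intro i ρ
    -- a `C⁰` tolerance `δ` with `δ ‖Λᵢ‖² < 1`
    obtain ⟨δ, hδpos, hδΛ⟩ : ∃ δ : ℝ, 0 < δ ∧
        δ * ‖(((d.motion i).1 : E4 ≃L[ℝ] E4) : E4 →L[ℝ] E4)‖ ^ 2 < 1 :=
      ⟨1 / (‖(((d.motion i).1 : E4 ≃L[ℝ] E4) : E4 →L[ℝ] E4)‖ ^ 2 + 1), by positivity, by
        rw [div_mul_eq_mul_div, one_mul, div_lt_one (by positivity)]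
        linarith⟩
    filter_upwards [hnear i 0 ρ (ENNReal.ofReal δ) (ENNReal.ofReal_pos.mpr hδpos)] with τ hτ
    obtain ⟨M, a, hmM, -, -, hdev, -, hV⟩ := hτ
    intro x hx w hw
    exact symm_apply_zero_pos_of_isFutureDirected (d.background i)
      (boostedKerrBilin (d.motion i).1 (d.motion i).2 M a) (d.chart i) (d.motion i).1 (d.motion i).2
      (h0.le.trans hmM) hδpos hδΛ hdev hx (fun v w => boostedKerrBilin_apply _ _ _ _ _ _ _)
      (hV x hx) hw
  · intro i k ρ ε hε
    filter_upwards [hnear i k ρ ε hε] with τ hτ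
    obtain ⟨M, a, h1, h2, h3, h4, h5, -⟩ := hτ
    exact ⟨M, a, h1, h2, h3, h4, h5⟩

end Summit.FinalStateConjecture.FinalStateConjecture.Theorems.LogTimeThreeAnnuli.SubconvergentEraGeneric

end
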